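import Literature.AnabelianGeometry.SemiGraphs.PSCRamification
import Literature.AnabelianGeometry.SemiGraphs.CharacteristicOpenCoreProP
import Literature.AnabelianGeometry.SemiGraphs.PSCCuspidalCriterionOriginReduction
import HarnessLib

/-!
# [IUTchI] Rmk. 1.2.3 (iv), cuspidal part: the converse half follows from the direct half (profinite, topologically finitely generated `Π`)

Mochizuki, *Inter-universal Teichmüller theory I* [IUTchI] Rmk. 1.2.3 (iv), kurims manuscript pp. 41–42:
"the cuspidal edge-like subgroups of `Π_G` may be characterized as the maximal closed subgroups `A ⊆ Π_G`
isomorphic to `ℤ_l` which satisfy the following condition: for every characteristic open subgroup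
`Π_{G'} ⊆ Π_G` … the cyclic finite étale covering `G' → G''` is cuspidally totally ramified" — typed by
abc-iut-L3-t4 as the `iff` `PSCDatum.CuspidalEdgeLikeCharacterization` (`PSCRamification.lean`, abc-iut
FACT-LIST row F-1930; origin form `CuspidalEdgeLikeCharacterizationHolds Ω`, row F-1931).  PROOF-ONLY
file (abc-iut-f-164, FACT tranche 164).

Write `cond(A)` for the typed condition (closed, topologically procyclic, infinite, and for every
characteristic open `U` the covering `U ≤ A·U` is cuspidally totally ramified in the typed sense:
`((A·U) ∩ γΠ_c)·U = A·U` for some cusp `c` and some `γ`).  The typed `iff` has a DIRECT half — every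
cuspidal subgroup satisfies `cond` and is maximal for it — and a CONVERSE half — every `cond`-maximal
subgroup is cuspidal.  PROVED HERE (`isCuspidal_of_condMaximal_of_forall_cuspidal_cond`): for EVERY datum
`G : PSCDatum Π` over a profinite, topologically finitely generated, pro-`p` group `Π` (at `Σ = {l}` the
pro-`l`-ness is the datum's own field `proSigma`), **the converse half follows from "every cuspidal
subgroup satisfies `cond`"** — no hypothesis on the shape of the semi-graph.  Steps:
(1) `cond(A)` at a characteristic open `U` gives `A ≤ γ_U • Π_{c_U} ⊔ U`; (2) the cusps are finitely many
and characteristic open subgroups are stable under finite meets, so ONE cusp `c₀` serves every `U`;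
(3) the sets `{g | g⁻¹ A g ⊆ Π_{c₀}·U}` are closed, non-empty and directed in the compact `Π`, so ONE `g₀`
serves every `U`; (4) by SERRE's theorem (abstract automorphisms of a topologically finitely generated
pro-`p` group are continuous — the tree's `continuous_of_proP_of_finsetDense`, abc-iut-w5-d218) the
characteristic open cores of abc-iut-w4-d053 are characteristic in Mathlib's abstract sense and cofinal
among the open subgroups (`CharacteristicOpenCoreProP.lean`), whence `⋂_U Π_{c₀}·U = Π_{c₀}` and
`A ≤ g₀ • Π_{c₀}`; (5) `g₀ • Π_{c₀}` is cuspidal, so it satisfies `cond` by hypothesis, and maximality of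
`A` gives `A = g₀ • Π_{c₀}`.  Hence `cuspidalEdgeLikeCharacterization_of_mp` (the typed `iff` from its
direct half, datum level) and `cuspidalEdgeLikeCharacterizationHolds_of_mp` (**row F-1931 REDUCED to its
direct half at every origin of profinite topologically finitely generated data** — all pro-`Σ`
completions of finitely generated groups are such).  The direct half is a THEOREM at smooth-curve data
(abc-iut-L3-t4's `cuspidalEdgeLikeCharacterization_mp_of_smoothCurve`; composition in the companion
`PSCSmoothCurveCuspidalCharacterization.lean`).  Appended: with Prop. 1.2 (i) (row F-0459, or the
separating coverings F-2830) this gives [CombGC] Thm. 1.6 (i) as printed (row F-0458) at every pro-`l`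
profinite topologically finitely generated origin from the direct half alone
(`numericallyCuspidalIffHolds_of_openInter_of_mp`, over `PSCCuspidalCriterionOriginReduction.lean`).
No new `Prop` (the halves are displayed inline); nothing is asserted about all pointed stable curves;
nothing here takes a side on [IUTchIII] Cor. 3.12.
[cite: Mochizuki2012, IUTchI Rmk 1.2.3(iv) pp.41-42] [cite: DDMSAnalyticProP1999, Thm 1.17]
-/

noncomputable section

namespace Literature.AnabelianGeometry.SemiGraphs

namespace PSCDatum

open scoped Pointwise
open Literature.AnabelianGeometry.AbsoluteAnabelian (IsTopologicallyFinitelyGenerated)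

universe u

variable {P : Type u} [Group P] [TopologicalSpace P] [IsTopologicalGroup P]

omit [TopologicalSpace P] [IsTopologicalGroup P] in
/-- Membership in a conjugate: `a ∈ γ • S ↔ g⁻¹ a g ∈ S` for `γ = g`. [folklore] -/
private theorem mem_conj_smul_iff'' {S : Subgroup P} (γ : ConjAct P) (a : P) :
    a ∈ γ • S ↔ (ConjAct.ofConjAct γ)⁻¹ * a * ConjAct.ofConjAct γ ∈ S := by
  rw [Subgroup.mem_pointwise_smul_iff_inv_smul_mem, ConjAct.smul_def, ConjAct.ofConjAct_inv, inv_inv]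

omit [TopologicalSpace P] [IsTopologicalGroup P] in
/-- Characteristic subgroups are stable under binary intersection. [folklore] -/
private theorem characteristic_inf' {U₁ U₂ : Subgroup P} (h₁ : U₁.Characteristic)
    (h₂ : U₂.Characteristic) : (U₁ ⊓ U₂).Characteristic :=
  ⟨fun ϕ => by rw [Subgroup.comap_inf, h₁.fixed, h₂.fixed]⟩

omit [TopologicalSpace P] [IsTopologicalGroup P] in
/-- Characteristic subgroups are stable under intersections of families. [folklore] -/
private theorem characteristic_iInf' {ι : Type*} {U : ι → Subgroup P}
    (h : ∀ i, (U i).Characteristic) : (⨅ i, U i).Characteristic :=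
  ⟨fun ϕ => by
    rw [Subgroup.comap_iInf]
    exact iInf_congr fun i => (h i).fixed ϕ⟩

section Converse

variable [CompactSpace P] [TotallyDisconnectedSpace P]

/-- **[IUTchI] Rmk. 1.2.3 (iv), cuspidal part: the CONVERSE half from the direct half.**  Let `G` be a
PSC datum over a profinite, topologically finitely generated, pro-`p` group `Π`, and suppose every
cuspidal subgroup of `Π` satisfies the typed ramification condition `cond` (closed, topologically
procyclic, infinite, `U ≤ A·U` cuspidally totally ramified for every characteristic open `U`).  Then every
subgroup `A` satisfying `cond` and MAXIMAL among such subgroups is cuspidal.  (Steps (1)–(5) of the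
module docstring; step (4) is Serre's theorem via `mem_of_forall_characteristic_mem_sup`.)
[cite: Mochizuki2012, IUTchI Rmk 1.2.3(iv) pp.41-42] -/
theorem isCuspidal_of_condMaximal_of_forall_cuspidal_cond (G : PSCDatum P) {p : ℕ} [Fact p.Prime]
    (hP : ∀ U : OpenNormalSubgroup P, IsPGroup p (P ⧸ (U : Subgroup P)))
    (htfg : IsTopologicallyFinitelyGenerated P)
    (hmp : ∀ C : Subgroup P, G.IsCuspidal C →
      IsClosed (C : Set P) ∧ (∃ c : P, (Subgroup.zpowers c).topologicalClosure = C) ∧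
        (C : Set P).Infinite ∧
        ∀ U : Subgroup P, U.Characteristic → IsOpen (U : Set P) →
          G.IsCuspidallyTotallyRamified (C ⊔ U) U)
    {A : Subgroup P}
    (hcond : IsClosed (A : Set P) ∧ (∃ a : P, (Subgroup.zpowers a).topologicalClosure = A) ∧
        (A : Set P).Infinite ∧
        ∀ U : Subgroup P, U.Characteristic → IsOpen (U : Set P) →
          G.IsCuspidallyTotallyRamified (A ⊔ U) U)
    (hmax : ∀ B : Subgroup P,
      (IsClosed (B : Set P) ∧ (∃ b : P, (Subgroup.zpowers b).topologicalClosure = B) ∧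
          (B : Set P).Infinite ∧
          ∀ U : Subgroup P, U.Characteristic → IsOpen (U : Set P) →
            G.IsCuspidallyTotallyRamified (B ⊔ U) U) →
        A ≤ B → A = B) :
    G.IsCuspidal A := by
  -- Step 1: at each characteristic open `U`, `A ≤ γ • Π_c ⊔ U` for some cusp `c` and some `γ`
  have step1 : ∀ U : Subgroup P, U.Characteristic → IsOpen (U : Set P) →
      ∃ (c : G.graph.C) (γ : ConjAct P), A ≤ γ • G.cuspGp c ⊔ U := by
    intro U hUc hUo
    obtain ⟨-, c, γ, hcγ⟩ := hcond.2.2.2 U hUc hUo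
    refine ⟨c, γ, ?_⟩
    calc A ≤ A ⊔ U := le_sup_left
      _ = ((A ⊔ U) ⊓ γ • G.cuspGp c) ⊔ U := hcγ.symm
      _ ≤ γ • G.cuspGp c ⊔ U := sup_le_sup_right inf_le_right U
  -- Step 2: one cusp `c₀` serves every characteristic open `U`
  have step2 : ∃ c₀ : G.graph.C, ∀ U : Subgroup P, U.Characteristic → IsOpen (U : Set P) →
      ∃ γ : ConjAct P, A ≤ γ • G.cuspGp c₀ ⊔ U := by
    by_contra hno
    push Not at hno
    choose U hUc hUo hbad using hno
    have hU₀c : (⨅ c, U c).Characteristic := characteristic_iInf' hUc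
    have hU₀o : IsOpen ((⨅ c, U c : Subgroup P) : Set P) := by
      rw [Subgroup.coe_iInf]
      exact isOpen_iInter_of_finite fun c => hUo c
    obtain ⟨c₀, γ, hle⟩ := step1 _ hU₀c hU₀o
    exact hbad c₀ γ (hle.trans (sup_le_sup_left (iInf_le _ c₀) _))
  obtain ⟨c₀, hc₀⟩ := step2
  -- Step 3: compactness — one conjugator `g₀` serves every characteristic open `U`
  let J : Type u := {U : Subgroup P // U.Characteristic ∧ IsOpen (U : Set P)}
  let K : J → Set P := fun U => {x : P | ∀ a ∈ A, x⁻¹ * a * x ∈ G.cuspGp c₀ ⊔ U.1}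
  have hKdef : ∀ (U : J) (x : P), x ∈ K U ↔ ∀ a ∈ A, x⁻¹ * a * x ∈ G.cuspGp c₀ ⊔ U.1 :=
    fun _ _ => Iff.rfl
  -- `A ≤ γ • Π ⊔ U ↔ ofConjAct γ ∈ K U` (for `U` normal)
  have hKiff : ∀ (U : J) (γ : ConjAct P),
      A ≤ γ • G.cuspGp c₀ ⊔ U.1 ↔ ConjAct.ofConjAct γ ∈ K U := by
    intro U γ
    haveI : U.1.Characteristic := U.2.1
    have hN : γ • U.1 = U.1 := (inferInstance : U.1.Normal).conjAct γ
    have hconj : γ • (G.cuspGp c₀ ⊔ U.1) = γ • G.cuspGp c₀ ⊔ U.1 := by rw [Subgroup.smul_sup, hN]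
    rw [hKdef, ← hconj]
    exact ⟨fun hle a ha => (mem_conj_smul_iff'' γ a).mp (hle ha),
      fun hm a ha => (mem_conj_smul_iff'' γ a).mpr (hm a ha)⟩
  have hKne : ∀ U : J, (K U).Nonempty := fun U => by
    obtain ⟨γ, hγ⟩ := hc₀ U.1 U.2.1 U.2.2
    exact ⟨_, (hKiff U γ).mp hγ⟩
  have hKcl : ∀ U : J, IsClosed (K U) := fun U => by
    have hopen : IsOpen ((G.cuspGp c₀ ⊔ U.1 : Subgroup P) : Set P) :=
      Subgroup.isOpen_mono le_sup_right U.2.2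
    have hclosed : IsClosed ((G.cuspGp c₀ ⊔ U.1 : Subgroup P) : Set P) :=
      Subgroup.isClosed_of_isOpen _ hopen
    have hK : K U = ⋂ a ∈ A,
        (fun x : P => x⁻¹ * a * x) ⁻¹' ((G.cuspGp c₀ ⊔ U.1 : Subgroup P) : Set P) := by
      ext x
      simp only [Set.mem_iInter, Set.mem_preimage, SetLike.mem_coe]
      exact hKdef U x
    rw [hK]
    exact isClosed_biInter fun a _ =>
      hclosed.preimage ((continuous_inv.mul continuous_const).mul continuous_id)
  have hKdir : Directed (· ⊇ ·) K := by
    intro U₁ U₂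
    refine ⟨⟨U₁.1 ⊓ U₂.1, characteristic_inf' U₁.2.1 U₂.2.1, U₁.2.2.inter U₂.2.2⟩, ?_, ?_⟩
    · intro x hx a ha
      exact (sup_le_sup_left (inf_le_left : U₁.1 ⊓ U₂.1 ≤ U₁.1) _) (hx a ha)
    · intro x hx a ha
      exact (sup_le_sup_left (inf_le_right : U₁.1 ⊓ U₂.1 ≤ U₂.1) _) (hx a ha)
  haveI : Nonempty J := ⟨⟨⊤, inferInstance, by rw [Subgroup.coe_top]; exact isOpen_univ⟩⟩
  obtain ⟨g₀, hg₀⟩ := IsCompact.nonempty_iInter_of_directed_nonempty_isCompact_isClosed K hKdir hKne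
    (fun U => (hKcl U).isCompact) hKcl
  -- Step 4: `A ≤ g₀ • Π_{c₀}` (Serre's theorem: characteristic open subgroups are cofinal)
  have hAC : A ≤ ConjAct.toConjAct g₀ • G.cuspGp c₀ := by
    intro a ha
    rw [mem_conj_smul_iff'', ConjAct.ofConjAct_toConjAct]
    exact mem_of_forall_characteristic_mem_sup hP htfg (G.isClosed_cuspGp c₀) fun U hUc hUo =>
      (Set.mem_iInter.mp hg₀ ⟨U, hUc, hUo⟩) a ha
  -- Step 5: the cuspidal subgroup `g₀ • Π_{c₀}` satisfies `cond`; maximality of `A`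
  have hcusp : G.IsCuspidal (ConjAct.toConjAct g₀ • G.cuspGp c₀) := ⟨c₀, _, rfl⟩
  rw [hmax _ (hmp _ hcusp) hAC]
  exact hcusp

/-- **[IUTchI] Rmk. 1.2.3 (iv), cuspidal part, as typed (`CuspidalEdgeLikeCharacterization`, row
F-1930), FROM ITS DIRECT HALF**: over a profinite, topologically finitely generated `Π`, if every cuspidal
subgroup satisfies `cond` and is maximal for it, then the typed `iff` holds (the pro-`l`-ness needed by
Serre's theorem is the datum's field `proSigma` at `Σ = {l}`).
[cite: Mochizuki2012, IUTchI Rmk 1.2.3(iv) pp.41-42] -/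
theorem cuspidalEdgeLikeCharacterization_of_mp (G : PSCDatum P)
    (htfg : IsTopologicallyFinitelyGenerated P)
    (hmp : ∀ A : Subgroup P, G.IsCuspidal A →
      (IsClosed (A : Set P) ∧ (∃ a : P, (Subgroup.zpowers a).topologicalClosure = A) ∧
          (A : Set P).Infinite ∧
          ∀ U : Subgroup P, U.Characteristic → IsOpen (U : Set P) →
            G.IsCuspidallyTotallyRamified (A ⊔ U) U) ∧
        ∀ B : Subgroup P,
          (IsClosed (B : Set P) ∧ (∃ b : P, (Subgroup.zpowers b).topologicalClosure = B) ∧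
              (B : Set P).Infinite ∧
              ∀ U : Subgroup P, U.Characteristic → IsOpen (U : Set P) →
                G.IsCuspidallyTotallyRamified (B ⊔ U) U) →
            A ≤ B → A = B) :
    G.CuspidalEdgeLikeCharacterization := by
  intro l hSl
  dsimp only
  intro A
  haveI : Fact l.Prime := ⟨G.sigma_prime l (by rw [hSl]; exact Set.mem_singleton l)⟩
  have hpro : IsProSigma {l} P := hSl ▸ G.proSigma
  have hP : ∀ U : OpenNormalSubgroup P, IsPGroup l (P ⧸ (U : Subgroup P)) :=
    fun U => isPGroup_quotient_of_isProSigma_singleton hpro U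
  exact ⟨fun hA => hmp A hA, fun hA => G.isCuspidal_of_condMaximal_of_forall_cuspidal_cond hP htfg
    (fun C hC => (hmp C hC).1) hA.1 hA.2⟩

end Converse

/-! ### Origin level: row F-1931 reduced to its direct half -/

section Origin

variable (Ω : PSCOrigin.{u})

/-- **Row F-1931 (`CuspidalEdgeLikeCharacterizationHolds Ω`) REDUCED TO ITS DIRECT HALF at every origin
of profinite, topologically finitely generated data** (as all pro-`Σ` completions of finitely generated
groups are — Def. 1.1 (ii), p. 6): if at every datum of `Ω`-PSC-type every cuspidal subgroup satisfies
the typed ramification condition and is maximal for it (displayed inline), then [IUTchI] Rmk. 1.2.3 (iv)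
(cuspidal part) as typed holds at `Ω`. [cite: Mochizuki2012, IUTchI Rmk 1.2.3(iv) pp.41-42] -/
theorem cuspidalEdgeLikeCharacterizationHolds_of_mp
    (hprof : ∀ ⦃Q : Type u⦄ [Group Q] [TopologicalSpace Q] [IsTopologicalGroup Q] (G : PSCDatum Q),
      Ω.IsOfPSCType G →
        CompactSpace Q ∧ TotallyDisconnectedSpace Q ∧ IsTopologicallyFinitelyGenerated Q)
    (hmp : ∀ ⦃Q : Type u⦄ [Group Q] [TopologicalSpace Q] [IsTopologicalGroup Q] (G : PSCDatum Q),
      Ω.IsOfPSCType G → ∀ A : Subgroup Q, G.IsCuspidal A →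
        (IsClosed (A : Set Q) ∧ (∃ a : Q, (Subgroup.zpowers a).topologicalClosure = A) ∧
            (A : Set Q).Infinite ∧
            ∀ U : Subgroup Q, U.Characteristic → IsOpen (U : Set Q) →
              G.IsCuspidallyTotallyRamified (A ⊔ U) U) ∧
          ∀ B : Subgroup Q,
            (IsClosed (B : Set Q) ∧ (∃ b : Q, (Subgroup.zpowers b).topologicalClosure = B) ∧
                (B : Set Q).Infinite ∧
                ∀ U : Subgroup Q, U.Characteristic → IsOpen (U : Set Q) →
                  G.IsCuspidallyTotallyRamified (B ⊔ U) U) →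
              A ≤ B → A = B) :
    CuspidalEdgeLikeCharacterizationHolds Ω := by
  intro Q _ _ _ G hG
  obtain ⟨hc, hd, htfg⟩ := hprof G hG
  exact G.cuspidalEdgeLikeCharacterization_of_mp htfg (hmp G hG)

end Origin

/-! ### Appended (abc-iut-f-164): [CombGC] Thm. 1.6 (i) at pro-`l` profinite origins from F-0459 and the direct half -/

section OriginThm16i

variable (Ω : PSCOrigin.{u}) (l : ℕ)

/-- **[CombGC] Theorem 1.6 (i) as printed (row F-0458) at every pro-`l` profinite, topologically finitely
generated origin, REDUCED to Prop. 1.2 (i) as printed (row F-0459) and the DIRECT half of [IUTchI] Rmk.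
1.2.3 (iv)** (no hypothesis on the semi-graphs — multi-vertex data included): the converse half of the
cuspidal characterization is `cuspidalEdgeLikeCharacterizationHolds_of_mp`, the rest is
`numericallyCuspidalIffHolds_of_characterization` (`PSCCuspidalCriterionOriginReduction.lean`).
[cite: MochizukiCombGC2007, Thm 1.6(i) p.13] -/
theorem numericallyCuspidalIffHolds_of_openInter_of_mp
    (hprof : ∀ ⦃Q : Type u⦄ [Group Q] [TopologicalSpace Q] [IsTopologicalGroup Q] (G : PSCDatum Q),
      Ω.IsOfPSCType G →
        CompactSpace Q ∧ TotallyDisconnectedSpace Q ∧ IsTopologicallyFinitelyGenerated Q)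
    (hSig : ∀ ⦃Q : Type u⦄ [Group Q] [TopologicalSpace Q] [IsTopologicalGroup Q] (G : PSCDatum Q),
      Ω.IsOfPSCType G → G.Sigma = {l})
    (h12 : OpenInterDeterminesComponentHolds Ω)
    (hmp : ∀ ⦃Q : Type u⦄ [Group Q] [TopologicalSpace Q] [IsTopologicalGroup Q] (G : PSCDatum Q),
      Ω.IsOfPSCType G → ∀ A : Subgroup Q, G.IsCuspidal A →
        (IsClosed (A : Set Q) ∧ (∃ a : Q, (Subgroup.zpowers a).topologicalClosure = A) ∧
            (A : Set Q).Infinite ∧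
            ∀ U : Subgroup Q, U.Characteristic → IsOpen (U : Set Q) →
              G.IsCuspidallyTotallyRamified (A ⊔ U) U) ∧
          ∀ B : Subgroup Q,
            (IsClosed (B : Set Q) ∧ (∃ b : Q, (Subgroup.zpowers b).topologicalClosure = B) ∧
                (B : Set Q).Infinite ∧
                ∀ U : Subgroup Q, U.Characteristic → IsOpen (U : Set Q) →
                  G.IsCuspidallyTotallyRamified (B ⊔ U) U) →
              A ≤ B → A = B) :
    NumericallyCuspidalIffHolds Ω :=
  numericallyCuspidalIffHolds_of_characterization Ω l
    (fun _ _ _ _ G hG => ⟨(hprof G hG).1, (hprof G hG).2.1⟩) hSig h12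
    (cuspidalEdgeLikeCharacterizationHolds_of_mp Ω hprof hmp)

/-- The same with Prop. 1.2 (i) itself derived from the separating coverings (row F-2830,
abc-iut-w5-d183's `openInterDeterminesComponentHolds_of_separating`): F-0458 ⇐ F-2830 + the direct half
of F-1931 at every pro-`l` profinite topologically finitely generated origin.
[cite: MochizukiCombGC2007, Thm 1.6(i) p.13] -/
theorem numericallyCuspidalIffHolds_of_separating_of_mp
    (hprof : ∀ ⦃Q : Type u⦄ [Group Q] [TopologicalSpace Q] [IsTopologicalGroup Q] (G : PSCDatum Q),
      Ω.IsOfPSCType G →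
        CompactSpace Q ∧ TotallyDisconnectedSpace Q ∧ IsTopologicallyFinitelyGenerated Q)
    (hSig : ∀ ⦃Q : Type u⦄ [Group Q] [TopologicalSpace Q] [IsTopologicalGroup Q] (G : PSCDatum Q),
      Ω.IsOfPSCType G → G.Sigma = {l})
    (hsep : SeparatingCoveringsHolds Ω)
    (hmp : ∀ ⦃Q : Type u⦄ [Group Q] [TopologicalSpace Q] [IsTopologicalGroup Q] (G : PSCDatum Q),
      Ω.IsOfPSCType G → ∀ A : Subgroup Q, G.IsCuspidal A →
        (IsClosed (A : Set Q) ∧ (∃ a : Q, (Subgroup.zpowers a).topologicalClosure = A) ∧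
            (A : Set Q).Infinite ∧
            ∀ U : Subgroup Q, U.Characteristic → IsOpen (U : Set Q) →
              G.IsCuspidallyTotallyRamified (A ⊔ U) U) ∧
          ∀ B : Subgroup Q,
            (IsClosed (B : Set Q) ∧ (∃ b : Q, (Subgroup.zpowers b).topologicalClosure = B) ∧
                (B : Set Q).Infinite ∧
                ∀ U : Subgroup Q, U.Characteristic → IsOpen (U : Set Q) →
                  G.IsCuspidallyTotallyRamified (B ⊔ U) U) →
              A ≤ B → A = B) :
    NumericallyCuspidalIffHolds Ω :=
  numericallyCuspidalIffHolds_of_openInter_of_mp Ω l hprof hSig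
    (openInterDeterminesComponentHolds_of_separating Ω hsep
      fun _ _ _ _ G hG => ⟨(hprof G hG).1, (hprof G hG).2.1⟩) hmp

end OriginThm16i

end PSCDatum

end Literature.AnabelianGeometry.SemiGraphs

end
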